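import Mathlib

/-!
# Finite Fourier inversion with a prescribed isotypic component — the elementary core of the lead's R-B
complex-side reduction (INBOX L6576 (1)–(2), item (5))

Blind re-derivation cell `pub-hodge-repro`, seat `t3-p4` (Tier 3, T3.5; the lead's L6576 item (5) — t3-p1 g2 first,
t3-p4 g2 alternate, coordination line S9870).  Target tree path `lean/Summits/Ventures/HodgeRepro/Tier3FourierInversion.lean`;
Mathlib only.

The lead's chain (L6576 (1)): for fixed `n` the vector `(L(½, χ_j′ε))_{ε ∈ Ĉl′_n}` is the Fourier transform on the finite
abelian group `Cl′_n` of `a ↦ c(a) · δ^κE(x_n(a))`, so ONE point of the toric orbit where the function is non-zero gives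
ONE character `ε` with a non-zero central value — «finite Fourier inversion, elementary»; and (L6576 (2)) the
TRIVIAL-`Δ`-branch statement (`ε|_Δ = ψ₀` prescribed on a subgroup `Δ`) is the non-vanishing of the `ψ₀`-isotypic
projection `a ↦ Σ_{d ∈ Δ} ψ₀(d) g(a + d)`.  This file proves exactly these two statements for a finite abelian group `α`
(written additively; a multiplicative `CommGroup G` is `Additive G`) and `g : α → ℂ`:

* (A) `exists_addChar_sum_mul_ne_zero`: `g ≠ 0 → ∃ ψ : AddChar α ℂ, Σ_a ψ a * g a ≠ 0` (the characters form a basis of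
  `α → ℂ`, Mathlib `AddChar.complexBasis`; pair the delta function at a point where `g` is non-zero against `g`);
* (B) `exists_sum_isotypic_ne_zero_iff`: for a subgroup `H ≤ α` and `ψ₀ : AddChar H ℂ`,
  `(∃ a, Σ_{h ∈ H} ψ₀ h * g (a + h) ≠ 0) ↔ ∃ ψ : AddChar α ℂ, ψ|_H = ψ₀ ∧ Σ_a ψ a * g a ≠ 0`
  (the identity `Σ_a ψ a * Σ_h ψ₀ h * g (a + h) = (Σ_h ψ₀ h / ψ h) * Σ_a ψ a * g a`, `sum_mul_sum_isotypic`, and the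
  orthogonality `AddChar.sum_eq_zero_iff_ne_zero` on `H`).
  With `ψ₀(-h)` in place of `ψ₀(h)` (the lead's wording) the statement is the same for `ψ₀⁻¹`.

HONESTY.  Finite harmonic analysis on Mathlib; nothing here is about L-values — the identification of the vector of
central values with a Fourier transform is the lead's reading of He 2025 Cor 4.11 and stays on paper.  HC_CM is NOT
proved by anyone in this repository.
-/

set_option autoImplicit false

open Finset

namespace HodgeRepro.Tier3

variable {α : Type*} [AddCommGroup α] [Fintype α]

/-- **(A) Finite Fourier inversion**: a non-zero function on a finite abelian group pairs non-trivially with some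
complex character. -/
theorem exists_addChar_sum_mul_ne_zero (g : α → ℂ) (hg : g ≠ 0) :
    ∃ ψ : AddChar α ℂ, ∑ a, ψ a * g a ≠ 0 := by
  classical
  obtain ⟨a₀, ha₀⟩ : ∃ a, g a ≠ 0 := Function.ne_iff.mp hg
  by_contra h
  have hall : ∀ ψ : AddChar α ℂ, ∑ a, ψ a * g a = 0 := fun ψ => by
    by_contra h'
    exact h ⟨ψ, h'⟩
  -- the delta function at `a₀`, expanded in the basis of characters
  let δ : α → ℂ := fun b => if b = a₀ then 1 else 0
  have hδ := (AddChar.complexBasis α).sum_repr δ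
  have h1 : ∑ b, δ b * g b = g a₀ := by simp [δ]
  have h2 : ∑ b, δ b * g b =
      ∑ ψ : AddChar α ℂ, (AddChar.complexBasis α).repr δ ψ * ∑ b, ψ b * g b := by
    conv_lhs => rw [← hδ]
    simp only [Finset.sum_apply, Pi.smul_apply, AddChar.complexBasis_apply, smul_eq_mul, Finset.sum_mul,
      Finset.mul_sum]
    rw [Finset.sum_comm]
    refine Finset.sum_congr rfl fun ψ _ => Finset.sum_congr rfl fun b _ => ?_
    ring
  rw [h2] at h1
  simp only [hall, mul_zero, Finset.sum_const_zero] at h1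
  exact ha₀ h1.symm

/-- The pairing of a character `ψ` with the `ψ₀`-isotypic projection `a ↦ Σ_{h ∈ H} ψ₀ h * g (a + h)` factors as
`(Σ_{h ∈ H} ψ₀ h / ψ h) · (Σ_a ψ a * g a)`. -/
theorem sum_mul_sum_isotypic (H : AddSubgroup α) [Fintype H] (ψ₀ : AddChar H ℂ) (g : α → ℂ) (ψ : AddChar α ℂ) :
    ∑ a, ψ a * ∑ h : H, ψ₀ h * g (a + h) = (∑ h : H, ψ₀ h / ψ h) * ∑ a, ψ a * g a := by
  simp only [Finset.mul_sum, Finset.sum_mul]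
  rw [Finset.sum_comm]
  conv_rhs => rw [Finset.sum_comm]
  refine Finset.sum_congr rfl fun h _ => ?_
  -- re-index the inner sum by `a ↦ a + h`
  have hre : ∑ a, ψ a * (ψ₀ h * g (a + h)) = ∑ a, ψ (a - h) * (ψ₀ h * g a) :=
    Fintype.sum_equiv (Equiv.addRight (h : α)) _ _ (fun a => by simp)
  rw [hre]
  refine Finset.sum_congr rfl fun a _ => ?_
  rw [AddChar.map_sub_eq_div]
  ring

omit [Fintype α] in
/-- The restriction of a character of `α` to a subgroup `H`. -/
theorem restrict_apply (H : AddSubgroup α) (ψ : AddChar α ℂ) (h : H) :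
    ψ.compAddMonoidHom H.subtype h = ψ h := rfl

/-- **(B) Fourier inversion with a prescribed isotypic component**: for a subgroup `H ≤ α` and `ψ₀ : AddChar H ℂ`, the
`ψ₀`-isotypic projection `a ↦ Σ_{h ∈ H} ψ₀ h * g (a + h)` is not identically zero iff some character `ψ` of `α`
EXTENDING `ψ₀` pairs non-trivially with `g`. -/
theorem exists_sum_isotypic_ne_zero_iff (H : AddSubgroup α) [Fintype H] (ψ₀ : AddChar H ℂ) (g : α → ℂ) :
    (∃ a, ∑ h : H, ψ₀ h * g (a + h) ≠ 0) ↔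
      ∃ ψ : AddChar α ℂ, ψ.compAddMonoidHom H.subtype = ψ₀ ∧ ∑ a, ψ a * g a ≠ 0 := by
  classical
  constructor
  · rintro ⟨a, ha⟩
    -- (A) applied to the isotypic projection
    obtain ⟨ψ, hψ⟩ := exists_addChar_sum_mul_ne_zero (fun a => ∑ h : H, ψ₀ h * g (a + h))
      (fun h0 => ha (by simpa using congrFun h0 a))
    rw [sum_mul_sum_isotypic] at hψ
    obtain ⟨h1, h2⟩ := mul_ne_zero_iff.mp hψ
    refine ⟨ψ, ?_, h2⟩
    -- orthogonality on `H`: `Σ_h ψ₀ h / ψ h ≠ 0` forces `ψ₀ = ψ|_H`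
    have h3 : ∑ h : H, (ψ₀ / ψ.compAddMonoidHom H.subtype) h ≠ 0 := by
      simpa [AddChar.div_apply', restrict_apply] using h1
    have h4 := AddChar.sum_ne_zero_iff_eq_zero.mp h3
    -- `ψ₀ / ψ|_H = 0` (the trivial character) means `ψ₀ = ψ|_H`
    have h5 : ψ₀ / ψ.compAddMonoidHom H.subtype = 1 := h4
    exact (div_eq_one.mp h5).symm
  · rintro ⟨ψ, hψ, hne⟩
    by_contra h
    have hall : ∀ a, ∑ h : H, ψ₀ h * g (a + h) = 0 := fun a => by
      by_contra h'
      exact h ⟨a, h'⟩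
    have key := sum_mul_sum_isotypic H ψ₀ g ψ
    simp only [hall, mul_zero, Finset.sum_const_zero] at key
    have hc : ∑ h : H, ψ₀ h / ψ h = Fintype.card H := by
      have : ∀ h : H, ψ₀ h / ψ h = 1 := fun h => by
        rw [← hψ, restrict_apply, div_self (ψ.val_isUnit (h : α)).ne_zero]
      simp [this]
    rw [hc] at key
    exact hne ((mul_eq_zero.mp key.symm).resolve_left (Nat.cast_ne_zero.mpr Fintype.card_ne_zero))

section Multiplicative

variable {G : Type*} [CommGroup G] [Fintype G]

/-- (A) for a MULTIPLICATIVE finite commutative group `G` (the lead's wording), through `Additive G`. -/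
theorem exists_addChar_sum_mul_ne_zero_mul (g : G → ℂ) (hg : g ≠ 0) :
    ∃ ψ : AddChar (Additive G) ℂ, ∑ a : G, ψ (Additive.ofMul a) * g a ≠ 0 := by
  have hg' : (fun x : Additive G => g (Additive.toMul x)) ≠ 0 := fun h => hg (funext fun a => congrFun h (Additive.ofMul a))
  obtain ⟨ψ, hψ⟩ := exists_addChar_sum_mul_ne_zero (α := Additive G) (fun x => g (Additive.toMul x)) hg'
  refine ⟨ψ, ?_⟩
  have heq : ∑ a : G, ψ (Additive.ofMul a) * g a = ∑ x : Additive G, ψ x * g (Additive.toMul x) :=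
    Fintype.sum_equiv Additive.ofMul _ _ (fun a => rfl)
  rw [heq]
  exact hψ

end Multiplicative

end HodgeRepro.Tier3
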